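import Summits.AtomisticToContinuum.BoseEinsteinCondensation.Theses.BECInsertionCorrector
import Summits.AtomisticToContinuum.BoseEinsteinCondensation.Theorems.BECInsertionCorrectorCorrectorClosureNearMinimiserRigidity
import Summits.AtomisticToContinuum.BoseEinsteinCondensation.Theorems.BECInsertionCorrectorCorrectorClosureGroundStateExists
import Summits.AtomisticToContinuum.BoseEinsteinCondensation.Theorems.BECConjugateDominationHardCoreExtensionGroundStateRegularity
import Summits.AtomisticToContinuum.BoseEinsteinCondensation.Theorems.BECFeynmanVortexAreaTorusGroundStateOfRegularity
import Summits.AtomisticToContinuum.BoseEinsteinCondensation.Theorems.BECInsertionCorrectorCorrectorClosureMixedLawResidue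
import Summits.AtomisticToContinuum.BoseEinsteinCondensation.Theorems.BECInsertionCorrectorCorrectorClosureTiltCorrector
import Summits.AtomisticToContinuum.BoseEinsteinCondensation.Theorems.BECInsertionCorrectorCorrectorClosureGroundStateFrame
import Literature.MathematicalPhysics.QuantumManyBody.WeightedCorrector
import HarnessLib.Audit

/-!
# Line `geometric-mean-corrector` — skeleton v2 for the crux `BECInsertionCorrector.CorrectorClosure`
(crux item stmt-AtomisticToContinuum-12058, rank 3, route `route-AtomisticToContinuum-BECInsertionCorrector`;
v1 by the crux-plan seat planner-cruxplan-stmt-AtomisticToContinuum-12058-geometric-mean-corre-0, 2026-08-15;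
v2 by the eighth line lead prover-line-stmt-AtomisticToContinuum-12058-c4-0, 2026-08-16)

Crux (FIXED, by name): `CorrectorClosure := StaticResponseBound → InsertionResidue`.

Idea (card `Ideas/geometric-mean-corrector.md`, line card `Lines/geometric-mean-corrector.md`, triage
r1-1/2/3: pass): do not expand `ψ = −log h`, `h = |Φ|/|Θ∘tail|` (`Θ`, `Φ` the positive torus ground
states of `N` and `N+1` bodies), around the undressed law; use the Chernoff/Hölder path of tilts
`π_s ∝ h^{2s}|Θ∘tail|² dZ` and its MIDPOINT, the geometric-mean ("mixed estimator") law
`m = π_{1/2} ∝ |Θ∘tail|·|Φ| dZ`, under which `ψ` is ONE linear weak corrector of `W − μ_N`.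
Bhattacharyya–Kantorovich identity (planner): `Z_N = 1 / (E_m e^{u} · E_m e^{−u})`, `u = ψ − E_m ψ`,
`log E_m e^{u} = H(m‖π₀)` (INSERTION half), `log E_m e^{−u} = H(m‖π₁)` (REMOVAL half).

## v2 (this lead) — the line aligned with the tree's Feynman–Kac frame; 3 of the 7 v1 stubs DISCHARGED

v1 ran the analysis on the bounded truncations `v_n = min(v,n)` and carried three frame stubs:
S0 `stub_truncationStableResponse` (K1 uniform over truncations), S1 `stub_truncationRemoval`
(monotone form convergence `E₀(v_n) ↑ E₀(v)`), S2 `stub_groundStateRigidity` (positive `C¹` ground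
states of `v_n` + fixed-`N` rigidity, uniform in `n`). For a BOUNDED admissible `v` all three are now
theorems of the tree (no truncation is needed: `v_n = v`):
* existence, continuity, positivity of the torus Feynman–Kac ground states eventually in `N` at fixed
  small density — `ResidueAreaLaw.stub_groundStateExists` (p92339, fed by `PeriodicGroundStateFeynmanKac_holds`);
* their `C¹`-regularity — `ThirdLawCurrentFloor.stub_periodicGroundStateRegularity` (crux HardCoreExtension);
* "a `C¹` FK ground state attains the periodic energy" —
  `TorusGroundState.periodicEnergy_le_of_isPeriodicGroundStateFK` (route BECFeynmanVortexArea);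
* fixed-`N` rigidity of near-minimisers — `HealingScaleKacInsertion.stub_nearMinimiserRigidity` (p85784).
They are assembled below in the sorry-free `groundStateFrame`. For an UNBOUNDED admissible `v` (hard or
singular cores) the content of S0–S2 is exactly the hole shared by every line of this crux, registered
here VERBATIM as `stub_unboundedCase` (same signature as `ResidueAreaLaw.stub_unboundedCase` /
`HealingScaleKacInsertion.stub_unboundedCase`, so that one landing serves all lines).

Registered stubs of v2 (5): `stub_mixedLawResidue` (S3, v1 verbatim, M, worker — LANDED p123708),
`stub_tiltCorrector` (S4, v1 verbatim, M–L, worker — LANDED p126261 over p125047, p125668), `stub_insertionHalf`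
(S5', bounded `v`, K1 BY NAME, XL, lead), `stub_removalHalf` (S6', bounded `v`, K1 BY NAME, XL hardest, lead),
`stub_unboundedCase` (hole, lead). v2.1: the two landed stubs are imported and used by name; v2.2 (this file): the
frame `groundStateFrame` and the reading lemmas are LANDED too (`Theorems/…GroundStateFrame.lean`, p126488) and imported;
3 sorries remain — the two halves and the hole. `CorrectorClosure_of` is sorry-free given the stubs and concludes the crux BY NAME.

What the two halves are worth (kernel-checked elsewhere, recorded here so that no reader mistakes the
line for an easier crux): S3 makes `S5' ∧ S6'` EQUIVALENT, for the true ground states, to an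
`N`-uniform floor on the insertion residue `A = L⁻³(∫Θ₀∫_cellΦ₀)²`, and `A ≤ f₀(Φ₀)` (Disproof §5,
`Negative.overlap_sq_le_taggedZeroModeOccupation`) makes that floor contain torus BEC of the
`(N+1)`-body ground state; at crux level `CorrectorClosure ∧ StaticResponseBound ⊢ PeriodicBEC-body`
for every admissible `v` (`periodicBEC_of_correctorClosure`, p121285). So `S5' ∧ S6'` is at least
`StaticResponseBound → PeriodicBEC` (item stmt-AtomisticToContinuum-8997) for bounded `v`.

Disproof.lean (gen 4 v10) honoured: §1 K1 is consumed BY NAME in S5'/S6' (and the hole); §3/§7 the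
window `δ = δ(N, ε)` is produced AFTER `N` by `stub_nearMinimiserRigidity` inside the glue; §4
`E₀^per < ⊤` enters through `IsPeriodicGroundStateFK.energy_ne_top`; §5/§8 the constant is
`e^{−(C_U+C_D)}/2 < 1`; §9 n/a; §10 every threshold is `∃ ρᵢ > 0`; §13 the dimension test lives in
S5'/S6' (their Bogoliubov values are the `d = 3` recoil integral); §16 no `H₋₁` constant below `1/2` is
asserted anywhere. No `-- Targets` theorem of Disproof v10 names a stub of this line.
-/

noncomputable section

namespace Summit.AtomisticToContinuum.BoseEinsteinCondensation.Cruxes.CorrectorClosure.GeometricMeanCorrector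

open MeasureTheory Filter
open scoped ENNReal NNReal ComplexConjugate BigOperators
open Literature.MathematicalPhysics.QuantumManyBody.BoseGas
open Summit.AtomisticToContinuum.BoseEinsteinCondensation.Theses.BECInsertionCorrector
open Summit.AtomisticToContinuum.BoseEinsteinCondensation.Theorems.CorrectorClosure.ResidueAreaLaw
  (stub_groundStateExists)
open Summit.AtomisticToContinuum.BoseEinsteinCondensation.Theorems.CorrectorClosure.HealingScaleKacInsertion
  (stub_nearMinimiserRigidity overlap_ofReal)
open Summit.AtomisticToContinuum.BoseEinsteinCondensation.Cruxes.HardCoreExtension.ThirdLawCurrentFloor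
  (stub_periodicGroundStateRegularity)
open Summit.AtomisticToContinuum.BoseEinsteinCondensation.Theorems.TorusGroundState
  (periodicEnergy_le_of_isPeriodicGroundStateFK)
open Summit.AtomisticToContinuum.BoseEinsteinCondensation.Theorems.CorrectorClosure.GeometricMeanCorrector
  (stub_mixedLawResidue stub_tiltCorrector exists_trialState_of_fk realPos_of_ofReal residue_ofReal_eq groundStateFrame)

set_option linter.unusedVariables false

/-! ## S3 `stub_mixedLawResidue` and S4 `stub_tiltCorrector` — LANDED by wave 1 of this lead (v2.1)

* S3 (the Bhattacharyya–Kantorovich identity `e^{−(U+D)} ≤ residue(Θ,Φ)` from the two unit exponential moments of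
  the centred midpoint corrector under the mixed law): `Theorems/BECInsertionCorrectorCorrectorClosureMixedLawResidue.lean`
  (p123708; reusable: `integral_mixedLaw`, `overlap_eq_mixedMass`).
* S4 (the whole tilt family of weak corrector identities `−𝓛_s ψ = (W − μ_N) + (2s−1)|∇ψ|²` for the weight
  `|Θ∘tail|^{1−s}|Φ|^s`, for ALL periodic `C¹` tests): `Theorems/BECInsertionCorrectorCorrectorClosureTiltCorrector.lean`
  (p126261) over `…TiltCorrectorAux.lean` (p125047: `tilt_el_all`, the weak Euler–Lagrange equation of a positive
  minimiser against all periodic `C¹` tests by Bose symmetrisation) and `…TiltCorrectorLift.lean` (p125668: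
  `tilt_el_tail`, the `N`-body equation lifted to `Config (N+1)`; pair-sum split `V_{N+1} = V_N∘tail + W`).
Both are imported above and used BY NAME in `CorrectorClosure_of`; their registered signatures are unchanged. -/

/-! ## S5' — the insertion half: `H(m ‖ π₀) ≤ C` uniformly (bounded `v`, K1 by name) -/

/-- **S5' `stub_insertionHalf`** (v2 form: bounded admissible `v`, `StaticResponseBound` BY NAME; v1 carried the
K1-clause of the truncation family instead). Given K1, for every BOUNDED repulsive finite-range `v` there are
`ρ₀ > 0` and `C` such that for `0 < ρ < ρ₀`, all large `N`, and every pair of real positive `C¹` ground states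
`(Θ, Φ)` of the `N`- and `(N+1)`-body problems on the torus of side `L_N = ((N+1)/ρ)^{1/3}` satisfying the
tilt-corrector identities of S4: the UPPER unit exponential moment of the centred midpoint corrector is bounded,
`E_m exp(ψ − E_mψ) ≤ e^{C}` — equivalently `H(m‖π₀) ≤ C`, equivalently `4∫₀^{1/2} s·Var_{π_s}ψ ds ≤ C`
(configurations where the insertion amplitude `h` is SMALL: impurity squeezed against bath particles). Why plausibly
true: at `s = 0` the law is the PRODUCT `|Θ|² ⊗ dy` and the first corrector of `W̃` has the recoil-regularised `L²`
bound `(ρ/4)∫|v̂|² m₋₁(k) k⁻² d³k < ∞` in `d = 3` from K1 (per density mode: support `StaticResponseToHMinusOne` +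
Parseval in `y` + `(ω+k²)⁻² ≤ (4ωk²)⁻¹`; the `N`-uniform `H₋₁` brick is LANDED as
`ResidueAreaLaw.stub_firstCorrectorBound`, p117568); Bogoliubov value of the whole half `≈ ½‖χ₁‖² ≈ 0.9√(ρa³)`.
Honest difficulty: for `s ∈ (0, ½]` the generator `𝓛₀ − 2s∇ψ·∇` is not a product (no recoil lemma) and beyond
first order the source is the two-mode functional `|∇χ₁|² − E|∇χ₁|²` (the route's `χ₂` difficulty). Together with
S6' this stub is at least `StaticResponseBound → PeriodicBEC` for bounded `v` (module docstring). Size: XL (open). -/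
theorem stub_insertionHalf (hK1 : StaticResponseBound) (v : ℝ → ℝ≥0∞) (hv : IsRepulsiveFiniteRange v)
    (hbdd : ∃ C : ℝ≥0, ∀ r, v r ≤ C) :
    ∃ ρ₀ : ℝ, 0 < ρ₀ ∧ ∃ C : ℝ, ∀ ρ : ℝ, 0 < ρ → ρ < ρ₀ → ∀ᶠ N : ℕ in atTop,
      ∀ (Θ : PeriodicTrialState N (sideLength ρ (N + 1)))
        (Φ : PeriodicTrialState (N + 1) (sideLength ρ (N + 1))),
        (∀ X, Θ.ψ X = (‖Θ.ψ X‖ : ℂ) ∧ 0 < ‖Θ.ψ X‖) →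
        (∀ Z, Φ.ψ Z = (‖Φ.ψ Z‖ : ℂ) ∧ 0 < ‖Φ.ψ Z‖) →
        periodicEnergy v Θ = periodicGroundStateEnergy v N (sideLength ρ (N + 1)) →
        periodicEnergy v Φ = periodicGroundStateEnergy v (N + 1) (sideLength ρ (N + 1)) →
        periodicEnergy v Θ ≠ ⊤ → periodicEnergy v Φ ≠ ⊤ →
        ∀ (ψ : Config (N + 1) → ℝ),
          (ψ = fun Z => -Real.log (‖Φ.ψ Z‖ / ‖Θ.ψ (Fin.tail Z)‖)) →
          (∀ s : ℝ,
            IsWeakCorrector (sideLength ρ (N + 1))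
              (fun Z : Config (N + 1) => ‖Θ.ψ (Fin.tail Z)‖ ^ (1 - s) * ‖Φ.ψ Z‖ ^ s)
              (fun Z : Config (N + 1) =>
                (∑ j : Fin N, (periodizedPotential v (sideLength ρ (N + 1)) (Z 0 - Z j.succ)).toReal)
                  - ((periodicGroundStateEnergy v (N + 1) (sideLength ρ (N + 1))).toReal
                      - (periodicGroundStateEnergy v N (sideLength ρ (N + 1))).toReal)
                  + (2 * s - 1) * gradDot ψ ψ Z)
              ψ) →
          ∀ (m : Measure (Config (N + 1))),
            (m = (((volume : Measure (Config (N + 1))).restrict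
                    (cellN (N + 1) (sideLength ρ (N + 1)))).withDensity
                    (fun Z => (‖Θ.ψ (Fin.tail Z)‖₊ : ℝ≥0∞) ^ 2)).tilted (fun Z => -ψ Z)) →
            ∫ Z, Real.exp (ψ Z - ∫ Z', ψ Z' ∂m) ∂m ≤ Real.exp C := by
  sorry

/-! ## S6' — the removal half: `H(m ‖ π₁) ≤ C` uniformly (bounded `v`, K1 by name; the infrared heart) -/

/-- **S6' `stub_removalHalf` (HARDEST; v2 form: bounded admissible `v`, `StaticResponseBound` BY NAME).** Same frame
as S5'; conclusion: the LOWER unit exponential moment of the centred midpoint corrector is bounded,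
`E_m exp(−(ψ − E_mψ)) ≤ e^{C}` — equivalently `H(m‖π₁) ≤ C`, equivalently `4∫_{1/2}^{1} (1−s)·Var_{π_s}ψ ds ≤ C`
(configurations where `h` is LARGE: the impurity in a void of the full ground state `π₁ = |Φ|²`). Why plausibly
true: on `s ∈ (½, 1]` every input is an ENERGY — the relative Fisher information of the tilts is
`4s²E_{π_s}|∇ψ|² = 4s²(μ_N − E_{π_s}W)/(2s−1) ≤ 4s²μ_N/(2s−1)` (S4 tested on `1`, `W ≥ 0`), and `h⁻¹ = |Θ∘tail|/|Φ|`
is the principal eigenfunction of the REMOVAL operator `−𝓛₁ − W` over the `(N+1)`-body ground-state diffusion; its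
`L²`-flatness is an `ω⁻²` response of the `(N+1)`-bath to removing the coupling of one particle, controlled in
Bogoliubov theory by the same compressibility integral as the insertion (`½‖χ₁‖² ≈ 0.9√(ρa³)`), and K1 is
available at `N+1`. Honest difficulty (triage r1-1/3, line card "the device is still to be found"): `π₁` has no
product structure, so the recoil lemma is unavailable and Kipnis–Varadhan gives `H₋₁`, not `L²`; every
functional-inequality conversion of the Fisher budget (Holley–Stroock, log-Sobolev, weak Poincaré) degenerates with
the finite-volume gap `∼ 1/L²`; an abstract equal-Γ comparison is FALSE (metastable double wells). Together with
S5' this stub is at least `StaticResponseBound → PeriodicBEC` for bounded `v` (module docstring). This stub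
decides the line. Size: XL (open). -/
theorem stub_removalHalf (hK1 : StaticResponseBound) (v : ℝ → ℝ≥0∞) (hv : IsRepulsiveFiniteRange v)
    (hbdd : ∃ C : ℝ≥0, ∀ r, v r ≤ C) :
    ∃ ρ₀ : ℝ, 0 < ρ₀ ∧ ∃ C : ℝ, ∀ ρ : ℝ, 0 < ρ → ρ < ρ₀ → ∀ᶠ N : ℕ in atTop,
      ∀ (Θ : PeriodicTrialState N (sideLength ρ (N + 1)))
        (Φ : PeriodicTrialState (N + 1) (sideLength ρ (N + 1))),
        (∀ X, Θ.ψ X = (‖Θ.ψ X‖ : ℂ) ∧ 0 < ‖Θ.ψ X‖) →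
        (∀ Z, Φ.ψ Z = (‖Φ.ψ Z‖ : ℂ) ∧ 0 < ‖Φ.ψ Z‖) →
        periodicEnergy v Θ = periodicGroundStateEnergy v N (sideLength ρ (N + 1)) →
        periodicEnergy v Φ = periodicGroundStateEnergy v (N + 1) (sideLength ρ (N + 1)) →
        periodicEnergy v Θ ≠ ⊤ → periodicEnergy v Φ ≠ ⊤ →
        ∀ (ψ : Config (N + 1) → ℝ),
          (ψ = fun Z => -Real.log (‖Φ.ψ Z‖ / ‖Θ.ψ (Fin.tail Z)‖)) →
          (∀ s : ℝ,
            IsWeakCorrector (sideLength ρ (N + 1))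
              (fun Z : Config (N + 1) => ‖Θ.ψ (Fin.tail Z)‖ ^ (1 - s) * ‖Φ.ψ Z‖ ^ s)
              (fun Z : Config (N + 1) =>
                (∑ j : Fin N, (periodizedPotential v (sideLength ρ (N + 1)) (Z 0 - Z j.succ)).toReal)
                  - ((periodicGroundStateEnergy v (N + 1) (sideLength ρ (N + 1))).toReal
                      - (periodicGroundStateEnergy v N (sideLength ρ (N + 1))).toReal)
                  + (2 * s - 1) * gradDot ψ ψ Z)
              ψ) →
          ∀ (m : Measure (Config (N + 1))),
            (m = (((volume : Measure (Config (N + 1))).restrict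
                    (cellN (N + 1) (sideLength ρ (N + 1)))).withDensity
                    (fun Z => (‖Θ.ψ (Fin.tail Z)‖₊ : ℝ≥0∞) ^ 2)).tilted (fun Z => -ψ Z)) →
            ∫ Z, Real.exp (-(ψ Z - ∫ Z', ψ Z' ∂m)) ∂m ≤ Real.exp C := by
  sorry

/-! ## The hole — unbounded (hard / singular core) potentials (shared verbatim with the other lines) -/

/-- **Stub — the unbounded (hard / singular core) case: the crux itself for unbounded admissible potentials; typed
VERBATIM as `ResidueAreaLaw.stub_unboundedCase` / `HealingScaleKacInsertion.stub_unboundedCase` (UNDELEGATED; the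
honest hole of every line of this crux, = v1's S0 + S1 + S2 for unbounded `v`).** For an admissible `v` that is NOT
bounded (hard cores `v = ⊤` on a set of radii, or finite but unbounded cores) the Feynman–Kac chain has no input:
the tree's torus Feynman–Kac theory is stated and proved for BOUNDED periodised potentials only
(`PeriodicHeatFlowSpectral.lean`). What a proof would need: EITHER (i) the hard-core FK frame — connectivity of
the dilute free region `{|xᵢ−xⱼ|_𝕋 > R₀}` (`ρR₀³ ≪ 1`; open in print at fixed packing fraction,
Baryshnikov–Bubenik–Kahle 2014 §6), positivity improving of the killed semigroup on it, `E₀^per < ⊤` eventually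
(Ruelle), small-time form bounds for `C¹` states vanishing on the cores — and then the bounded-case chain verbatim;
OR (ii) v1's truncation route `v_n = min(v, n) ↑ v` with the bounded-case constants `(ρ₀, c)` UNIFORM in `n`
(v1 S0: a truncation-uniform K1, not supplied by K1 as typed) plus `E₀^per(v_n) ↑ E₀^per(v)` at fixed `N, L`
(v1 S1: monotone form convergence + Hedberg synthesis). Crux-sized by construction (it is `StaticResponseBound →`
the body of `InsertionResidue` for unbounded `v`); registered so that the composition is honest and the hole is
attackable by name. Diluteness (Disproof §10) respected: `∃ ρ₀ > 0`. Size XL (open).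
[cite: LSSY2005, Thm 2.5 (E₀ < ⊤ via Dyson's lemma)] -/
theorem stub_unboundedCase (hK1 : StaticResponseBound) (v : ℝ → ℝ≥0∞) (hv : IsRepulsiveFiniteRange v)
    (hub : ¬ ∃ C : ℝ≥0, ∀ r, v r ≤ C) :
    ∃ ρ₀ : ℝ, 0 < ρ₀ ∧ ∀ ρ : ℝ, 0 < ρ → ρ < ρ₀ → ∃ c : ℝ, 0 < c ∧ ∀ᶠ N : ℕ in Filter.atTop,
      ∃ δ : ENNReal, 0 < δ ∧ ∃ Θ : PeriodicTrialState N (sideLength ρ (N + 1)),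
        periodicEnergy v Θ ≤ periodicGroundStateEnergy v N (sideLength ρ (N + 1)) + δ ∧
        ∀ Ψ : PeriodicTrialState (N + 1) (sideLength ρ (N + 1)),
          periodicEnergy v Ψ ≤ periodicGroundStateEnergy v (N + 1) (sideLength ρ (N + 1)) + δ →
          ENNReal.ofReal c ≤ ENNReal.ofReal ((sideLength ρ (N + 1) ^ 3)⁻¹) *
            (‖∫ X in cellN N (sideLength ρ (N + 1)), conj (Θ.ψ X) *
                ∫ x in cell (sideLength ρ (N + 1)), Ψ.ψ (Matrix.vecCons x X)‖₊ : ℝ≥0∞) ^ 2 := by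
  sorry

/-! ## Sorry-free helpers of the composition -/

/-- `L_N = ((N+1)/ρ)^{1/3} > 0` for `ρ > 0`. [folklore] -/
theorem sideLength_succ_pos' {ρ : ℝ} (hρ : 0 < ρ) (N : ℕ) : 0 < sideLength ρ (N + 1) := by
  unfold sideLength
  apply Real.rpow_pos_of_pos
  positivity

/-- `ENNReal` bookkeeping of the last step: `e^{-K} ≤ R₀`, `R₀ ≤ R + e^{-K}/2` give `e^{-K}/2 ≤ R`. [folklore] -/
theorem half_le_of_exp_le {K : ℝ} {R₀ R : ℝ≥0∞}
    (hZ : ENNReal.ofReal (Real.exp (-K)) ≤ R₀)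
    (hS : R₀ ≤ R + ENNReal.ofReal (Real.exp (-K) / 2)) :
    ENNReal.ofReal (Real.exp (-K) / 2) ≤ R := by
  have hpos : 0 ≤ Real.exp (-K) / 2 := by positivity
  have hsplit : ENNReal.ofReal (Real.exp (-K)) =
      ENNReal.ofReal (Real.exp (-K) / 2) + ENNReal.ofReal (Real.exp (-K) / 2) := by
    rw [← ENNReal.ofReal_add hpos hpos]
    congr 1
    ring
  have h := hZ.trans hS
  rw [hsplit] at h
  exact (ENNReal.add_le_add_iff_right ENNReal.ofReal_ne_top).1 h

/-! ## The composition: the registered stubs give the crux BY NAME -/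

/-- **`CorrectorClosure` from the line `geometric-mean-corrector`, v2** (kernel-checked, no `sorry` of its own).
Unbounded `v`: `stub_unboundedCase`. Bounded `v`, given K1: thresholds `min ρᵢ`; eventually in `N` the
ground-state frame (`groundStateFrame`: FK ground states `Θ₀`, `Φ₀`, positive, `C¹`, attaining `E₀` as the
trial states `Θ`, `Φ`); S4 gives the tilt-corrector identities for `(Θ, Φ)`; S5'/S6' bound the two unit
exponential moments of the centred midpoint corrector by `e^{C_U}`, `e^{C_D}`; S3 turns them into
`e^{−(C_U+C_D)} ≤ residue(Θ, Φ) = A` (the residue of the TRUE ground states, `residue_ofReal_eq`); rigidity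
(`stub_nearMinimiserRigidity` at `ε = e^{−(C_U+C_D)}/2`, window `δ` produced AFTER `N`) transfers it to
`Res(Θ', Ψ) ≥ e^{−(C_U+C_D)}/2` for some `δ`-near-minimiser `Θ'` and every `δ`-near-minimiser `Ψ`. [folklore] -/
theorem CorrectorClosure_of : CorrectorClosure := by
  intro hK1 v hv
  by_cases hbdd : ∃ C : ℝ≥0, ∀ r, v r ≤ C
  swap
  · exact stub_unboundedCase hK1 v hv hbdd
  have hbddM : ∃ M : ℝ≥0∞, M ≠ ⊤ ∧ ∀ r, v r ≤ M := by
    obtain ⟨C, hC⟩ := hbdd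
    exact ⟨C, ENNReal.coe_ne_top, fun r => hC r⟩
  obtain ⟨ρ₁, hρ₁, hframe⟩ := groundStateFrame v hv hbdd
  obtain ⟨ρU, hρU, CU, hU⟩ := stub_insertionHalf hK1 v hv hbdd
  obtain ⟨ρD, hρD, CD, hD⟩ := stub_removalHalf hK1 v hv hbdd
  refine ⟨min ρ₁ (min ρU ρD), lt_min hρ₁ (lt_min hρU hρD), fun ρ hρ hρlt => ?_⟩
  have hρ1 : ρ < ρ₁ := hρlt.trans_le (min_le_left _ _)
  have hρU' : ρ < ρU := hρlt.trans_le ((min_le_right _ _).trans (min_le_left _ _))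
  have hρD' : ρ < ρD := hρlt.trans_le ((min_le_right _ _).trans (min_le_right _ _))
  set K : ℝ := CU + CD with hK
  refine ⟨Real.exp (-K) / 2, by positivity, ?_⟩
  filter_upwards [hframe ρ hρ hρ1, hU ρ hρ hρU', hD ρ hρ hρD'] with N hN1 hN2 hN3
  set L : ℝ := sideLength ρ (N + 1) with hL_def
  have hL : 0 < L := sideLength_succ_pos' hρ N
  obtain ⟨hb, ⟨hΘ, hΘc, hΘp⟩, ⟨hΦ, hΦc, hΦp⟩, Θ, Φ, hΘψ, hΦψ, hΘE, hΦE, hΘfin, hΦfin⟩ := hN1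
  set Θ₀ : Config N → ℝ := periodicFKGroundState v N L with hΘ₀_def
  set Φ₀ : Config (N + 1) → ℝ := periodicFKGroundState v (N + 1) L with hΦ₀_def
  have hΘpos := realPos_of_ofReal hΘp Θ hΘψ
  have hΦpos := realPos_of_ofReal hΦp Φ hΦψ
  -- S4: the tilt-corrector identities for the bounded potential `v`
  have hcorr := stub_tiltCorrector v hv hbddM N L hL Θ Φ hΘpos hΦpos hΘE hΦE hΘfin hΦfin _ rfl
  -- S5' / S6' at (N, Θ, Φ)
  have hu := hN2 Θ Φ hΘpos hΦpos hΘE hΦE hΘfin hΦfin _ rfl hcorr _ rfl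
  have hd := hN3 Θ Φ hΘpos hΦpos hΘE hΦE hΘfin hΦfin _ rfl hcorr _ rfl
  -- S3: the identity turns the two moment bounds into a residue bound for (Θ, Φ) = the true ground states
  have hZ := stub_mixedLawResidue N L hL Θ Φ hΘpos hΦpos _ _ rfl rfl CU CD hu hd
  rw [residue_ofReal_eq L Θ Φ hΘψ hΦψ] at hZ
  -- rigidity at `ε = e^{-K}/2`: transfer to the near-minimiser frame
  obtain ⟨δ, hδ, Θ', hΘ'E, hΨ⟩ := stub_nearMinimiserRigidity v hv N L hL hb Θ₀ hΘ hΘc hΘp Φ₀ hΦ hΦc hΦp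
    (Real.exp (-K) / 2) (by positivity)
  refine ⟨δ, hδ, Θ', hΘ'E, fun Ψ hΨE => ?_⟩
  exact half_le_of_exp_le hZ (hΨ Ψ hΨE)

end Summit.AtomisticToContinuum.BoseEinsteinCondensation.Cruxes.CorrectorClosure.GeometricMeanCorrector

end
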